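import Mathlib.Analysis.Normed.Group.Basic
import Summits.Parity.GeneralizedHardyLittlewood.Theorems.GreenTaoLevelTwoMNTwoPolarization

/-!
# Route `GreenTaoLevelTwo`, crux `MNTwo` (stmt-Parity-21276), line `birth`, stub `stub_mnVertical`:
# Lemma 27, per-`l` step: diagonal major arcs give `‖4l·q_l φ''(h,h')‖ ≲ ‖h‖²` (GT 2008b §11)

Tool for block V5 of the `stub_mnVertical` census (B. Green, T. Tao, *Quadratic uniformity of the
Möbius function*, Ann. Inst. Fourier 58 (2008) = arXiv:math/0606087, §11, proof of Lemma 27: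
"`4lφ''(h,h') = φ''(h+lh',h+lh') − φ''(h−lh',h−lh')`.  Applying Lemma 26 and the triangle
inequality, we infer `‖4lφ''(h,h')‖_{ℝ/ℤ,Q₁} ≲ ‖h‖_g²` and hence `‖lφ''(h,h')‖_{ℝ/ℤ,4Q₁} ≲ ‖h‖_g²`
for all `l ∈ {1,…,L}`").  Precisely (the print is loose about combining the two denominators): if
the DIAGONAL values are major arc — for every `a` with `ν(a) < ρ₀` some `1 ≤ q ≤ Q₁` has
`‖q•φ''(a,a)‖ ≤ K ν(a)²` — then for `h, h'` and an integer `l` with `ν h, ν h', |l|ν h' < r`,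
`3r ≤ ρ₀`, `6r ≤ R`, there are `q₊, q₋ ∈ [1, Q₁]` with
`‖(q₊q₋·4l)•φ''(h,h')‖ ≤ 18 Q₁ K r²`.  Abstract symmetric gauge, values in a normed additive
group (for `ℝ/ℤ` take `UnitAddCircle`); def-free.  The remaining steps of Lemma 27 (pigeonholing
`(q₊,q₋)` over `l ≤ L` and the Vinogradov lemma `…MNTwoRecurrentLinearAmplified`) are separate.

* `norm_natCast_zsmul_le` — `‖(m:ℕ)•x‖ ≤ m‖x‖`;
* `depolarize_step` — the statement above.

References: [GreenTao2008QuadraticMobius] arXiv:math/0606087 §11, proof of Lemma 27.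
-/

namespace Summit.Parity.GeneralizedHardyLittlewood.GreenTaoLevelTwoMNTwoDepolarizeStep

open Summit.Parity.GeneralizedHardyLittlewood.GreenTaoLevelTwoMNTwoLocalQuadratic (gauge_nsmul_le)
open Summit.Parity.GeneralizedHardyLittlewood.GreenTaoLevelTwoMNTwoPolarization
  (gauge_zsmul_le polarization)

variable {G : Type*} [NormedAddCommGroup G]

/-- `‖(m : ℕ) • x‖ ≤ m ‖x‖` in any normed additive group (re-export of `norm_nsmul_le`). [folklore] -/
theorem norm_natCast_zsmul_le (m : ℕ) (x : G) : ‖((m : ℤ)) • x‖ ≤ m * ‖x‖ := by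
  rw [natCast_zsmul]; exact norm_nsmul_le

/-- **Lemma 27, per-`l` step (GT 2008b §11).**  Let `φ` be locally quadratic on the gauge ball
`B(n₀, R)` for a symmetric gauge `ν`, and suppose the diagonal values are major arc: for every `a`
with `ν a < ρ₀` there is `1 ≤ q ≤ Q₁` with `‖q•φ''(a,a)‖ ≤ K ν(a)²` (`K ≥ 0`).  If `ν h < r`,
`ν h' < r`, `|l| ν h' < r`, `3r ≤ ρ₀` and `6r ≤ R`, then there are naturals `q₊, q₋ ∈ [1, Q₁]` with
`‖((q₊ q₋ : ℕ) * (4l)) • φ''(h,h')‖ ≤ 18 Q₁ K r²`.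
[cite: GreenTao2008QuadraticMobius, §11, proof of Lemma 27] -/
theorem depolarize_step (ν : ℤ → ℝ) (hν0 : ν 0 = 0) (hνnn : ∀ x, 0 ≤ ν x)
    (hνneg : ∀ x, ν (-x) = ν x) (hνadd : ∀ x y, ν (x + y) ≤ ν x + ν y) (φ : ℤ → G) {n₀ : ℤ}
    {R : ℝ}
    (hφ : ∀ n a b c : ℤ, ν (n - n₀) < R → ν (n + a - n₀) < R → ν (n + b - n₀) < R →
      ν (n + c - n₀) < R → ν (n + a + b - n₀) < R → ν (n + a + c - n₀) < R →
      ν (n + b + c - n₀) < R → ν (n + a + b + c - n₀) < R →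
      φ (n + a + b + c) - φ (n + a + b) - φ (n + a + c) - φ (n + b + c)
        + φ (n + a) + φ (n + b) + φ (n + c) - φ n = 0)
    {ρ₀ Q₁ K r : ℝ} (hK : 0 ≤ K) (hQ₁ : 1 ≤ Q₁)
    (h26 : ∀ a : ℤ, ν a < ρ₀ → ∃ q : ℕ, 1 ≤ q ∧ (q : ℝ) ≤ Q₁ ∧
      ‖((q : ℤ)) • (φ (n₀ + a + a) - φ (n₀ + a) - φ (n₀ + a) + φ n₀)‖ ≤ K * ν a ^ 2)
    {h h' : ℤ} (l : ℤ) (hh : ν h < r) (hh' : ν h' < r) (hlh' : |(l : ℝ)| * ν h' < r)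
    (hρ : 3 * r ≤ ρ₀) (hR : 6 * r ≤ R) :
    ∃ q₁ q₂ : ℕ, 1 ≤ q₁ ∧ (q₁ : ℝ) ≤ Q₁ ∧ 1 ≤ q₂ ∧ (q₂ : ℝ) ≤ Q₁ ∧
      ‖(((q₁ * q₂ : ℕ) : ℤ) * (4 * l)) • (φ (n₀ + h + h') - φ (n₀ + h) - φ (n₀ + h') + φ n₀)‖ ≤
        18 * Q₁ * K * r ^ 2 := by
  have hr0 : 0 < r := lt_of_le_of_lt (hνnn h) hh
  have hk : ν (l * h') < r := lt_of_le_of_lt (gauge_zsmul_le ν hν0 hνneg hνadd h' l) hlh'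
  -- the two shifted diagonal points lie in `B(0, 2r) ⊆ B(0, ρ₀)`
  have hp : ν (h + l * h') < ρ₀ := by linarith [hνadd h (l * h')]
  have hm : ν (h + -(l * h')) < ρ₀ := by
    have : ν (-(l * h')) < r := by rw [hνneg]; exact hk
    linarith [hνadd h (-(l * h'))]
  obtain ⟨q₁, hq₁, hq₁Q, hb₁⟩ := h26 (h + l * h') hp
  obtain ⟨q₂, hq₂, hq₂Q, hb₂⟩ := h26 (h + -(l * h')) hm
  refine ⟨q₁, q₂, hq₁, hq₁Q, hq₂, hq₂Q, ?_⟩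
  have hpol := polarization ν hν0 hνnn hνneg hνadd φ hφ l hh hh' hlh' hR
  -- abbreviations
  set Dp := φ (n₀ + (h + l * h') + (h + l * h')) - φ (n₀ + (h + l * h')) - φ (n₀ + (h + l * h')) + φ n₀
    with hDp
  set Dm := φ (n₀ + (h + -(l * h')) + (h + -(l * h'))) - φ (n₀ + (h + -(l * h'))) -
    φ (n₀ + (h + -(l * h'))) + φ n₀ with hDm
  set D := φ (n₀ + h + h') - φ (n₀ + h) - φ (n₀ + h') + φ n₀ with hD
  -- `(q₁q₂·4l)•D = q₂•(q₁•Dp) − q₁•(q₂•Dm)`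
  have e : (((q₁ * q₂ : ℕ) : ℤ) * (4 * l)) • D =
      ((q₂ : ℤ)) • (((q₁ : ℤ)) • Dp) - ((q₁ : ℤ)) • (((q₂ : ℤ)) • Dm) := by
    rw [mul_zsmul, ← hpol, zsmul_sub, smul_smul, smul_smul]
    push_cast
    rw [mul_comm (q₂ : ℤ) (q₁ : ℤ)]
  rw [e]
  -- sizes of the two diagonal values
  have hνp : ν (h + l * h') ≤ 2 * r := by linarith [hνadd h (l * h')]
  have hνm : ν (h + -(l * h')) ≤ 2 * r := by
    have : ν (-(l * h')) < r := by rw [hνneg]; exact hk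
    linarith [hνadd h (-(l * h'))]
  have hsq_p : ν (h + l * h') ^ 2 ≤ (2 * r) ^ 2 := pow_le_pow_left₀ (hνnn _) hνp 2
  have hsq_m : ν (h + -(l * h')) ^ 2 ≤ (2 * r) ^ 2 := pow_le_pow_left₀ (hνnn _) hνm 2
  have hb₁' : ‖((q₁ : ℤ)) • Dp‖ ≤ K * (2 * r) ^ 2 := hb₁.trans (mul_le_mul_of_nonneg_left hsq_p hK)
  have hb₂' : ‖((q₂ : ℤ)) • Dm‖ ≤ K * (2 * r) ^ 2 := hb₂.trans (mul_le_mul_of_nonneg_left hsq_m hK)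
  have hq₁0 : (0 : ℝ) ≤ q₁ := Nat.cast_nonneg _
  have hq₂0 : (0 : ℝ) ≤ q₂ := Nat.cast_nonneg _
  calc ‖((q₂ : ℤ)) • (((q₁ : ℤ)) • Dp) - ((q₁ : ℤ)) • (((q₂ : ℤ)) • Dm)‖
      ≤ ‖((q₂ : ℤ)) • (((q₁ : ℤ)) • Dp)‖ + ‖((q₁ : ℤ)) • (((q₂ : ℤ)) • Dm)‖ := norm_sub_le _ _
    _ ≤ q₂ * ‖((q₁ : ℤ)) • Dp‖ + q₁ * ‖((q₂ : ℤ)) • Dm‖ :=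
        add_le_add (norm_natCast_zsmul_le q₂ _) (norm_natCast_zsmul_le q₁ _)
    _ ≤ Q₁ * (K * (2 * r) ^ 2) + Q₁ * (K * (2 * r) ^ 2) :=
        add_le_add (mul_le_mul hq₂Q hb₁' (norm_nonneg _) (by linarith))
          (mul_le_mul hq₁Q hb₂' (norm_nonneg _) (by linarith))
    _ = 8 * Q₁ * K * r ^ 2 := by ring
    _ ≤ 18 * Q₁ * K * r ^ 2 := by nlinarith [mul_nonneg (mul_nonneg (by linarith : (0:ℝ) ≤ Q₁) hK) (sq_nonneg r)]

end Summit.Parity.GeneralizedHardyLittlewood.GreenTaoLevelTwoMNTwoDepolarizeStep
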